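import Summits.Schanuel.Schanuel.Theorems.RootDecomp1KPiScale04

/-!
# RootDecomp1KPiScale — lens 6, generation 20 «NESTERENKO-MEASURED SCALE π» (frame G20: lane T = the hypothesis-free DISCHARGE of the strong measure (31) at ω̄(e^{−2π}) from the tree-proved Nesterenko Ch. 3 Thm 5.1 / Prop 4.11 / Prop 4.8 ⇒ `LogPowMeasure ![π, e^π]`; lane F = K-R27 (F₊) cells on the π-lines for every log-hyper-Liouville ratio) — EDITION 2 §8 ADDENDUM (bookkeeping continuation of lane T per VERDICT L1986 / K-R29 (i): `LogPowMeasure ![e^{−2π}, π]`, `LogPowMeasure θπ`, the literal `LogPowMeasure ![π, e^π]`, and the tree's π-anchor cells with the h52 binder removed — all hypothesis-free) — continuation (RootDecomp1KPiScale05): §8c re-indexing + square-root step for log-power measures + §8d the literal `LogPowMeasure ![π, e^π]` and the tree π-cells with h52 removed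

(lens-6 g20 `PiScale.lean` EDITION 2 [HOME/decomp-schanuel-lens-6/g20/ sha256 27ead95c…, 1257 l = edition 1 87044252… verbatim (only a §8 paragraph added to the module docstring) + §8 appended ll. 715–1254; NOTE/EDITION 2 L1994, REQUEST L1995 (+ correction L1996), critic @@ACK@@]; port by census-1 gen 17 as `RootDecomp1KPiScale04`–`05` after 01–03 (from edition 1): 04 = §8a reversal transfer (`revExp`, `revPoly`, `logPowMeasure_revScale`) + §8b `θq = (e^{−2π}, π)`, `logPowMeasure_thetaq`, `mvWeakMeasure_thetaq`, `sb_three_of_piIntAnchor_free`, `sb_three_one_pi_any_free`; 05 = §8c re-indexing + the square-root step (`logPowMeasure_comp_of_injective`, `logPowMeasure_swap`, `sgnTwist`, `sqNorm`, `halfExp`, `sqDesc`, `logPowMeasure_of_sq`) + §8d `logPowMeasure_pi_expPi_sq`, `logPowMeasure_θπ`, `mvWeakMeasure_θπ_free`, THE LITERAL `logPowMeasure_pi_expPi : LogPowMeasure ![π, e^π]`, `mvWeakMeasure_pi_expPi_free`, `sb_three_of_piLatAnchor_free`, `sb_three_of_pi_cexp_pi_free`.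
PORT EDITS: the three `set_option linter.*` dropped; 24 one-line docstrings (statement read-outs); `weight_eq` / `exp_le_of_totalDegree_le` private (+ per-part private copies); statements and proofs verbatim. `--supports stmt-Schanuel-33364`; no census credit; rung 0.)
-/

noncomputable section

open Complex IntermediateField
open MvPolynomial (aeval rename X C)
open Literature.NumberTheory.Transcendental
open Literature.NumberTheory.Transcendental.Nesterenko
open Literature.Barriers.Schanuel
open Summit.Schanuel.Schanuel.Theorems.RootDecomp1KHyper
open Summit.Schanuel.Schanuel.Theorems.RootDecomp1KHyper.HyperCell
open Summit.Schanuel.Schanuel.Theorems.RootDecomp1KGeneric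
open Summit.Schanuel.Schanuel.Theorems.RootDecomp1KRelLiouvilleCell
open Summit.Schanuel.Schanuel.Theorems.RootDecomp1KDarkLogSq
open Summit.Schanuel.Schanuel.Theorems.RootDecomp1KHyper.HyperCell.LatCell.Bilog (mvlen_rename)

namespace Summit.Schanuel.Schanuel.Theorems.RootDecomp1KPiScale

section Sq
open MvPolynomial

/-! ### §8c  Re-indexing and the square-root step for log-power measures -/

/-- A sub-tuple (injective re-indexing) of a log-power-measured tuple is log-power-measured. -/
theorem logPowMeasure_comp_of_injective {n m : ℕ} {θ : Fin n → ℂ} (hθ : LogPowMeasure θ)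
    {f : Fin m → Fin n} (hf : Function.Injective f) : LogPowMeasure (θ ∘ f) := by
  intro d
  obtain ⟨C, k, hC, h⟩ := hθ d
  refine ⟨C, k, hC, fun P hP hdeg => ?_⟩
  have hP' : rename f P ≠ 0 := fun h0 => hP (rename_injective f hf (by rw [h0, map_zero]))
  have h1 := h (rename f P) hP' ((totalDegree_rename_le f P).trans hdeg)
  rwa [aeval_rename, mvlen_rename_of_injective hf] at h1

/-- Swap of a log-power-measured pair. -/
theorem logPowMeasure_swap {x y : ℂ} (h : LogPowMeasure ![x, y]) : LogPowMeasure ![y, x] := by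
  have e : (![x, y] : Fin 2 → ℂ) ∘ Fin.rev = ![y, x] := by
    funext i
    match i with
    | 0 => rfl
    | 1 => rfl
  rw [← e]; exact logPowMeasure_comp_of_injective h Fin.rev_injective

/-- The sign twist `σ B (x, y) = B(−x, y)`, written on coefficients: `c_m ↦ (−1)^{m₀} c_m`. -/
def sgnTwist (B : MvPolynomial (Fin 2) ℤ) : MvPolynomial (Fin 2) ℤ :=
  ∑ m ∈ B.support, monomial m ((-1) ^ (m 0) * B.coeff m)

/-- `(sgnTwist B).coeff m = (-1) ^ (m 0) * B.coeff m`. -/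
theorem coeff_sgnTwist (B : MvPolynomial (Fin 2) ℤ) (m : Fin 2 →₀ ℕ) :
    (sgnTwist B).coeff m = (-1) ^ (m 0) * B.coeff m := by
  classical
  rw [sgnTwist, coeff_sum]
  by_cases hm : m ∈ B.support
  · rw [Finset.sum_eq_single_of_mem m hm fun m' _ hne => by rw [coeff_monomial, if_neg hne],
      coeff_monomial, if_pos rfl]
  · rw [notMem_support_iff.mp hm, mul_zero]
    refine Finset.sum_eq_zero fun m' hm' => ?_
    rw [coeff_monomial, if_neg]
    rintro rfl
    exact hm hm'

/-- `(sgnTwist B).support = B.support`. -/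
theorem support_sgnTwist (B : MvPolynomial (Fin 2) ℤ) : (sgnTwist B).support = B.support := by
  ext m
  simp [mem_support_iff, coeff_sgnTwist]

/-- `sgnTwist (sgnTwist B) = B`. -/
theorem sgnTwist_sgnTwist (B : MvPolynomial (Fin 2) ℤ) : sgnTwist (sgnTwist B) = B := by
  ext m
  rw [coeff_sgnTwist, coeff_sgnTwist, ← mul_assoc, ← mul_pow]
  norm_num

/-- `mvlen (sgnTwist B) = mvlen B`. -/
theorem mvlen_sgnTwist (B : MvPolynomial (Fin 2) ℤ) : mvlen (sgnTwist B) = mvlen B := by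
  unfold mvlen
  rw [support_sgnTwist]
  refine Finset.sum_congr rfl fun m _ => ?_
  rw [coeff_sgnTwist, abs_mul, abs_pow, abs_neg, abs_one, one_pow, one_mul]

/-- `(sgnTwist B).totalDegree = B.totalDegree`. -/
theorem totalDegree_sgnTwist (B : MvPolynomial (Fin 2) ℤ) :
    (sgnTwist B).totalDegree = B.totalDegree := by
  rw [totalDegree, totalDegree, support_sgnTwist]

/-- `sgnTwist B ≠ 0`. -/
theorem sgnTwist_ne_zero {B : MvPolynomial (Fin 2) ℤ} (hB : B ≠ 0) : sgnTwist B ≠ 0 := by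
  intro h
  apply hB
  have hs := support_sgnTwist B
  rw [h, support_zero] at hs
  ext m
  have : m ∉ B.support := by rw [← hs]; simp
  rw [notMem_support_iff.mp this, coeff_zero]

/-- `σ` as the substitution `x ↦ −x`. -/
theorem sgnTwist_eq_aeval (B : MvPolynomial (Fin 2) ℤ) :
    sgnTwist B = aeval (![-X 0, X 1] : Fin 2 → MvPolynomial (Fin 2) ℤ) B := by
  conv_rhs => rw [← support_sum_monomial_coeff B, map_sum]
  rw [sgnTwist]
  refine Finset.sum_congr rfl fun m _ => ?_
  rw [aeval_monomial, Finsupp.prod_pow, Fin.prod_univ_two, MvPolynomial.algebraMap_eq]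
  simp only [Matrix.cons_val_zero, Matrix.cons_val_one]
  rw [monomial_eq, Finsupp.prod_pow, Fin.prod_univ_two, C_mul, C_pow, C_neg, C_1,
    neg_pow (X 0 : MvPolynomial (Fin 2) ℤ)]
  ring

/-- `σ` is multiplicative. -/
theorem sgnTwist_mul (P Q : MvPolynomial (Fin 2) ℤ) : sgnTwist (P * Q) = sgnTwist P * sgnTwist Q := by
  rw [sgnTwist_eq_aeval, sgnTwist_eq_aeval, sgnTwist_eq_aeval, map_mul]

/-- Evaluation: `σB(x, y) = B(−x, y)`. -/
theorem aeval_sgnTwist (B : MvPolynomial (Fin 2) ℤ) (x y : ℂ) :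
    aeval ![x, y] (sgnTwist B) = aeval ![-x, y] B := by
  conv_rhs => rw [← support_sum_monomial_coeff B, map_sum]
  rw [sgnTwist, map_sum]
  refine Finset.sum_congr rfl fun m _ => ?_
  simp only [aeval_monomial, Finsupp.prod_pow, Fin.prod_univ_two, algebraMap_int_eq, eq_intCast,
    Matrix.cons_val_zero, Matrix.cons_val_one, Int.cast_mul, Int.cast_pow, Int.cast_neg,
    Int.cast_one, neg_pow x]
  ring

/-- The norm `N(B) := B · σB` (a polynomial in `x²` and `y`). -/
def sqNorm (B : MvPolynomial (Fin 2) ℤ) : MvPolynomial (Fin 2) ℤ := B * sgnTwist B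

/-- `sgnTwist (sqNorm B) = sqNorm B`. -/
theorem sgnTwist_sqNorm (B : MvPolynomial (Fin 2) ℤ) : sgnTwist (sqNorm B) = sqNorm B := by
  rw [sqNorm, sgnTwist_mul, sgnTwist_sgnTwist, mul_comm]

/-- Every monomial of `N(B)` has an even `x`-exponent. -/
theorem even_of_mem_support_sqNorm {B : MvPolynomial (Fin 2) ℤ} {m : Fin 2 →₀ ℕ}
    (hm : m ∈ (sqNorm B).support) : Even (m 0) := by
  by_contra hodd
  rw [Nat.not_even_iff_odd] at hodd
  have h := coeff_sgnTwist (sqNorm B) m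
  rw [sgnTwist_sqNorm, hodd.neg_one_pow, neg_mul, one_mul] at h
  exact (mem_support_iff.mp hm) (by omega)

/-- Halving the `x`-exponent. -/
def halfExp (m : Fin 2 →₀ ℕ) : Fin 2 →₀ ℕ :=
  Finsupp.single 0 (m 0 / 2) + Finsupp.single 1 (m 1)

/-- `halfExp m 0 = m 0 / 2`. -/
theorem halfExp_zero (m : Fin 2 →₀ ℕ) : halfExp m 0 = m 0 / 2 := by
  simp [halfExp, Finsupp.add_apply]

/-- `halfExp m 1 = m 1`. -/
theorem halfExp_one (m : Fin 2 →₀ ℕ) : halfExp m 1 = m 1 := by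
  simp [halfExp, Finsupp.add_apply]

/-- `m = m'`. -/
theorem halfExp_inj {m m' : Fin 2 →₀ ℕ} (hm : Even (m 0)) (hm' : Even (m' 0))
    (h : halfExp m = halfExp m') : m = m' := by
  have h0 := congrArg (fun f => f 0) h
  have h1 := congrArg (fun f => f 1) h
  simp only [halfExp_zero, halfExp_one] at h0 h1
  obtain ⟨a, ha⟩ := hm
  obtain ⟨b, hb⟩ := hm'
  ext i
  match i with
  | 0 => omega
  | 1 => exact h1

/-- The descent `Ñ` with `Ñ(x², y) = N(B)(x, y)`. -/
def sqDesc (B : MvPolynomial (Fin 2) ℤ) : MvPolynomial (Fin 2) ℤ :=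
  ∑ m ∈ (sqNorm B).support, monomial (halfExp m) ((sqNorm B).coeff m)

/-- `(sqDesc B).coeff (halfExp m₀) = (sqNorm B).coeff m₀`. -/
theorem coeff_sqDesc (B : MvPolynomial (Fin 2) ℤ) {m₀ : Fin 2 →₀ ℕ} (hm₀ : m₀ ∈ (sqNorm B).support) :
    (sqDesc B).coeff (halfExp m₀) = (sqNorm B).coeff m₀ := by
  classical
  rw [sqDesc, coeff_sum, Finset.sum_eq_single_of_mem m₀ hm₀]
  · rw [coeff_monomial, if_pos rfl]
  · intro m hm hne
    rw [coeff_monomial, if_neg]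
    intro h
    exact hne (halfExp_inj (even_of_mem_support_sqNorm hm) (even_of_mem_support_sqNorm hm₀) h)

/-- `sqNorm B ≠ 0`. -/
theorem sqNorm_ne_zero {B : MvPolynomial (Fin 2) ℤ} (hB : B ≠ 0) : sqNorm B ≠ 0 :=
  mul_ne_zero hB (sgnTwist_ne_zero hB)

/-- `sqDesc B ≠ 0`. -/
theorem sqDesc_ne_zero {B : MvPolynomial (Fin 2) ℤ} (hB : B ≠ 0) : sqDesc B ≠ 0 := by
  obtain ⟨m₀, hm₀⟩ := MvPolynomial.ne_zero_iff.mp (sqNorm_ne_zero hB)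
  intro h
  have hc := coeff_sqDesc B (mem_support_iff.mpr hm₀)
  rw [h, coeff_zero] at hc
  exact hm₀ hc.symm

/-- `mvlen (sqDesc B) ≤ mvlen B * mvlen B`. -/
theorem mvlen_sqDesc_le (B : MvPolynomial (Fin 2) ℤ) : mvlen (sqDesc B) ≤ mvlen B * mvlen B := by
  calc mvlen (sqDesc B)
      ≤ ∑ m ∈ (sqNorm B).support, mvlen (monomial (halfExp m) ((sqNorm B).coeff m)) :=
        mvlen_sum_le _ _
    _ = mvlen (sqNorm B) := by
        rw [show mvlen (sqNorm B) = ∑ m ∈ (sqNorm B).support, |(sqNorm B).coeff m| from rfl]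
        exact Finset.sum_congr rfl fun m _ => mvlen_monomial _ _
    _ ≤ mvlen B * mvlen (sgnTwist B) := mvlen_mul_le _ _
    _ = mvlen B * mvlen B := by rw [mvlen_sgnTwist]

/-- `(m.sum fun _ e => e) = m 0 + m 1`. -/
private theorem weight_eq (m : Fin 2 →₀ ℕ) : (m.sum fun _ e => e) = m 0 + m 1 := by
  rw [Finsupp.sum_fintype _ _ (fun _ => rfl), Fin.sum_univ_two]

/-- `(sqDesc B).totalDegree ≤ 2 * d`. -/
theorem totalDegree_sqDesc_le {B : MvPolynomial (Fin 2) ℤ} {d : ℕ} (hB : B.totalDegree ≤ d) :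
    (sqDesc B).totalDegree ≤ 2 * d := by
  rw [sqDesc]
  refine (totalDegree_finsetSum _ _).trans (Finset.sup_le fun m hm => ?_)
  have hw : (m.sum fun _ e => e) ≤ 2 * d := by
    refine (le_totalDegree hm).trans ?_
    rw [sqNorm]
    refine (totalDegree_mul _ _).trans ?_
    rw [totalDegree_sgnTwist]; omega
  rw [weight_eq] at hw
  calc (monomial (halfExp m) ((sqNorm B).coeff m)).totalDegree
      ≤ (halfExp m).sum fun _ e => e := totalDegree_monomial_le _ _
    _ = m 0 / 2 + m 1 := by rw [weight_eq, halfExp_zero, halfExp_one]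
    _ ≤ 2 * d := by omega

/-- **Evaluation of the descent**: `Ñ(u², y) = B(u, y) · B(−u, y)`. -/
theorem aeval_sqDesc (B : MvPolynomial (Fin 2) ℤ) (u y : ℂ) :
    aeval ![u ^ 2, y] (sqDesc B) = aeval ![u, y] B * aeval ![-u, y] B := by
  rw [← aeval_sgnTwist, ← map_mul, show B * sgnTwist B = sqNorm B from rfl]
  conv_rhs => rw [← support_sum_monomial_coeff (sqNorm B), map_sum]
  rw [sqDesc, map_sum]
  refine Finset.sum_congr rfl fun m hm => ?_
  have hev : 2 * (m 0 / 2) = m 0 := Nat.two_mul_div_two_of_even (even_of_mem_support_sqNorm hm)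
  simp only [aeval_monomial, Finsupp.prod_pow, Fin.prod_univ_two, Matrix.cons_val_zero,
    Matrix.cons_val_one, halfExp_zero, halfExp_one, ← pow_mul, hev]

/-- **Square-root step**: a log-power measure at `(u², y)` gives one at `(u, y)`. -/
theorem logPowMeasure_of_sq {u y : ℂ} (h : LogPowMeasure ![u ^ 2, y]) : LogPowMeasure ![u, y] := by
  intro d
  obtain ⟨C, k, hC, hm⟩ := h (2 * d)
  set M : ℝ := max 1 (max ‖u‖ ‖y‖) with hM
  have hM1 : 1 ≤ M := le_max_left _ _
  have hlogM : 0 ≤ Real.log M := Real.log_nonneg hM1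
  have hdM : 0 ≤ (d : ℝ) * Real.log M := mul_nonneg (Nat.cast_nonneg _) hlogM
  refine ⟨C * 2 ^ k + 1 + d * Real.log M, k + 1, by positivity, fun P hP hdeg => ?_⟩
  set Q := sqDesc P with hQdef
  have hQ0 : Q ≠ 0 := sqDesc_ne_zero hP
  have hQdeg : Q.totalDegree ≤ 2 * d := totalDegree_sqDesc_le hdeg
  have h1 := hm Q hQ0 hQdeg
  rw [hQdef, aeval_sqDesc, norm_mul] at h1
  rw [← hQdef] at h1
  -- sizes
  set L : ℝ := 1 + Real.log ((mvlen P : ℤ) : ℝ) with hL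
  have hlenP1 : (1 : ℝ) ≤ ((mvlen P : ℤ) : ℝ) := by exact_mod_cast one_le_mvlen hP
  have hlogP : 0 ≤ Real.log ((mvlen P : ℤ) : ℝ) := Real.log_nonneg hlenP1
  have hL1 : 1 ≤ L := by rw [hL]; linarith
  have hLk1 : 1 ≤ L ^ k := one_le_pow₀ hL1
  have hlenQ1 : (1 : ℝ) ≤ ((mvlen Q : ℤ) : ℝ) := by exact_mod_cast one_le_mvlen hQ0
  have hlenQ : ((mvlen Q : ℤ) : ℝ) ≤ ((mvlen P : ℤ) : ℝ) * ((mvlen P : ℤ) : ℝ) := by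
    have h' : ((mvlen Q : ℤ) : ℝ) ≤ ((mvlen P * mvlen P : ℤ) : ℝ) := by
      exact_mod_cast mvlen_sqDesc_le P
    simpa [Int.cast_mul] using h'
  have hlogQ : 1 + Real.log ((mvlen Q : ℤ) : ℝ) ≤ 2 * L := by
    have hlog := Real.log_le_log (by linarith) hlenQ
    rw [Real.log_mul (by linarith) (by linarith)] at hlog
    rw [hL]; linarith
  have hlogQ0 : 0 ≤ 1 + Real.log ((mvlen Q : ℤ) : ℝ) := by linarith [Real.log_nonneg hlenQ1]
  have hpowk : (1 + Real.log ((mvlen Q : ℤ) : ℝ)) ^ k ≤ 2 ^ k * L ^ k := by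
    rw [← mul_pow]; exact pow_le_pow_left₀ hlogQ0 hlogQ k
  -- the conjugate factor is small: ‖P(−u, y)‖ ≤ len P · M^d
  have hconj : ‖aeval ![-u, y] P‖ ≤ ((mvlen P : ℤ) : ℝ) * M ^ d := by
    refine norm_mvaeval_le_mvlen_mul_pow P _ hM1 (fun i => ?_) hdeg
    match i with
    | 0 => simp only [Matrix.cons_val_zero, norm_neg]
           exact (le_max_left _ _).trans (le_max_right _ _)
    | 1 => simp only [Matrix.cons_val_one]
           exact (le_max_right _ _).trans (le_max_right _ _)
  have hD : 0 < ((mvlen P : ℤ) : ℝ) * M ^ d := by positivity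
  -- ‖P(u,y)‖ ≥ exp(−C (1+log len Q)^k) / (len P · M^d)
  have h2 : Real.exp (-(C * (1 + Real.log ((mvlen Q : ℤ) : ℝ)) ^ k)) ≤
      ‖aeval ![u, y] P‖ * (((mvlen P : ℤ) : ℝ) * M ^ d) :=
    h1.trans (mul_le_mul_of_nonneg_left hconj (norm_nonneg _))
  have h3 : Real.exp (-(C * (1 + Real.log ((mvlen Q : ℤ) : ℝ)) ^ k)) / (((mvlen P : ℤ) : ℝ) * M ^ d) ≤
      ‖aeval ![u, y] P‖ := (div_le_iff₀ hD).mpr h2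
  refine le_trans ?_ h3
  rw [le_div_iff₀ hD]
  have hden : ((mvlen P : ℤ) : ℝ) * M ^ d =
      Real.exp (Real.log ((mvlen P : ℤ) : ℝ) + d * Real.log M) := by
    rw [Real.exp_add, Real.exp_log (by linarith), Real.exp_nat_mul, Real.exp_log (by linarith)]
  rw [hden, ← Real.exp_add, Real.exp_le_exp]
  have hA : C * (1 + Real.log ((mvlen Q : ℤ) : ℝ)) ^ k ≤ C * (2 ^ k * L ^ k) :=
    mul_le_mul_of_nonneg_left hpowk hC.le
  have hLk : L ^ k ≤ L ^ (k + 1) := pow_le_pow_right₀ hL1 (Nat.le_succ k)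
  have hLk1' : 1 ≤ L ^ (k + 1) := one_le_pow₀ hL1
  have hB : Real.log ((mvlen P : ℤ) : ℝ) ≤ L ^ (k + 1) := by
    have : Real.log ((mvlen P : ℤ) : ℝ) ≤ L := by rw [hL]; linarith
    exact this.trans (le_trans (le_of_eq (pow_one L).symm) (pow_le_pow_right₀ hL1 (Nat.succ_le_succ (Nat.zero_le k))))
  have hC' : (d : ℝ) * Real.log M ≤ d * Real.log M * L ^ (k + 1) := le_mul_of_one_le_right hdM hLk1'
  have h2k : 0 ≤ C * 2 ^ k := by positivity
  nlinarith [hA, hB, hC', mul_le_mul_of_nonneg_left hLk h2k]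

end Sq

/-! ### §8d  `LogPowMeasure (e^{π}, π)` = Nesterenko's pair `θπ` binder-free; the literal `(π, e^{π})`;
Hyper40's lattice-anchor cells binder-free -/

/-- `LogPowMeasure (π, (e^{π})²)` — swap of `θq`, then the reversal `y ↦ 1/y`. -/
theorem logPowMeasure_pi_expPi_sq : LogPowMeasure ![(Real.pi : ℂ), cexp (Real.pi : ℂ) ^ 2] := by
  have h := logPowMeasure_revScale (x := (Real.pi : ℂ)) (y := qπ) qπ_ne_zero (a := 1) one_ne_zero
    (logPowMeasure_swap (show LogPowMeasure ![qπ, (Real.pi : ℂ)] from logPowMeasure_thetaq))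
  have e : (((1 : ℤ) : ℂ)) / qπ = cexp (Real.pi : ℂ) ^ 2 := by
    rw [qπ_eq_zpow, zpow_neg, zpow_ofNat, Int.cast_one, one_div, inv_inv]
  rw [e] at h
  exact h

/-- **`LogPowMeasure θπ`, `θπ = (e^{π}, π)` — HYPOTHESIS-FREE** (square-root step `e^{π} = ((e^{π})²)^{1/2}`). -/
theorem logPowMeasure_θπ : LogPowMeasure LatCell.θπ :=
  show LogPowMeasure ![cexp (Real.pi : ℂ), (Real.pi : ℂ)] from
    logPowMeasure_of_sq (logPowMeasure_swap logPowMeasure_pi_expPi_sq)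

/-- **Hyper36's `mvWeakMeasure_θπ` WITHOUT `h52`.** -/
theorem mvWeakMeasure_θπ_free : MvWeakMeasure LatCell.θπ := logPowMeasure_θπ.mvWeakMeasure

/-- **THE LITERAL PAIR: `LogPowMeasure (π, e^{π})`, hypothesis-free** (cf. the registered Cor. 5.2, which only
gives the weak shape `MvWeakMeasure (π, e^{π})` and only as a hypothesis, `PiCells.mvWeakMeasure_pi_expPi_of_cor52`). -/
theorem logPowMeasure_pi_expPi : LogPowMeasure ![(Real.pi : ℂ), cexp (Real.pi : ℂ)] :=
  logPowMeasure_swap (show LogPowMeasure ![cexp (Real.pi : ℂ), (Real.pi : ℂ)] from logPowMeasure_θπ)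

/-- **PiCells' `mvWeakMeasure_pi_expPi_of_cor52` WITHOUT its hypothesis.** -/
theorem mvWeakMeasure_pi_expPi_free : MvWeakMeasure ![(Real.pi : ℂ), cexp (Real.pi : ℂ)] :=
  logPowMeasure_pi_expPi.mvWeakMeasure

/-- **Hyper40's MAIN lattice-anchor cell `sb_three_of_piLatAnchor` WITHOUT `h52`**: `span_ℤ z ∋ π` and
`∋ W(e^{π}, π)` for an integer polynomial `W` with `U·W + V·x₁ ≠ 0` for `(U, V) ≠ 0`, `z` hyper-lin-Liouville ⇒ `SB 3 z`. -/
theorem sb_three_of_piLatAnchor_free {z : Fin 3 → ℂ} (hz : LinearIndependent ℚ z)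
    (hH : HyperLinLiouville z) (hA : LatCell.HasPiLatAnchor z) : SB 3 z := by
  obtain ⟨hπ, W, hW, hm⟩ := hA
  have hθz : ∀ i, LatCell.θπ i ∈ adjoin ℚ (SFset z ∪ {I}) := by
    intro i
    match i with
    | 0 => exact cexp_mem_adjoin_of_mem_span hπ
    | 1 => exact mem_adjoin_of_mem_span hπ
  exact LatCell.sb_three_of_measuredLatAnchor hz hH mvWeakMeasure_θπ_free hθz W (MvPolynomial.X 1) hW hm
    (by simpa using hπ)

/-- **Hyper40's `sb_three_of_pi_cexp_pi` WITHOUT `h52`**: `span ∋ π, M e^{π}` (`M ≠ 0`), ANY third coordinate. -/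
theorem sb_three_of_pi_cexp_pi_free {z : Fin 3 → ℂ} (hz : LinearIndependent ℚ z) (hH : HyperLinLiouville z)
    (hπ : (Real.pi : ℂ) ∈ Submodule.span ℤ (Set.range z)) {M : ℤ} (hM : M ≠ 0)
    (he : (M : ℂ) * cexp (Real.pi : ℂ) ∈ Submodule.span ℤ (Set.range z)) : SB 3 z :=
  sb_three_of_piLatAnchor_free hz hH (LatCell.hasPiLatAnchor_of_pi_cexp_pi hπ hM he)

end Summit.Schanuel.Schanuel.Theorems.RootDecomp1KPiScale

end
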